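import Literature.NumberTheory.Sieve.MoebiusShiftedPrimesSmoothedDirichletMeanValue
import Literature.NumberTheory.Sieve.MoebiusShiftedPrimesPrimeCharacterSum
import HarnessLib

/-!
# Möbius on shifted primes — Propositions 3.4 and 3.2 of Lichtman 2020 AS PRINTED, from the
# Vinogradov–Korobov input

Topic `Literature/NumberTheory/Sieve`.  The closing file of the repair of the printed proof of
Proposition 5.1 of J. D. Lichtman, *Averages of the Möbius function on shifted primes*, Q. J. Math. 73
(2022) 729–757, arXiv:2009.08969v2 [Lichtman2020], at the printed exponent `P₁ = (log X)^{33A}`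
(`MoebiusShiftedPrimesSmoothedRamare.lean`, `…SmoothedMeanValues.lean`, `…SmoothedDirichletMeanValue.lean`).
Everything here is PROVED; the file introduces no definition and no named fact.  It discharges, up to
the one printed input of the paper that the tree does not prove — Lemma 4.5, the Vinogradov–Korobov bound
for prime character sums (`Lichtman2020_primeCharacterSum`), itself a consequence of Khale's explicit
Vinogradov–Korobov zero-free region for Dirichlet `L`-functions (`Khale2024_zeroFreeRegion`,
`Lichtman2020.PrimeCharSum.Lichtman2020_primeCharacterSum_of_khale`) — the two named facts of the tree
that render the printed Propositions 3.4 and 3.2 WITH THEIR PRINTED SAVINGS: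

* `Lichtman2020_liouvilleMeanSquare_of_primeCharacterSum`, `…_of_khale` — **Proposition 3.4**
  (`Lichtman2020_liouvilleMeanSquare`, `MoebiusShiftedPrimesMajorArcs.lean`: mean square `≪ h²Y/W¹⁰` of
  `λχ𝟙_S` in almost all short intervals, printed set, saving `W^{-10}`), by the printed "Proof of
  Proposition 3.4 from Proposition 5.1" (p. 14) run verbatim from Proposition 5.1 at the printed exponent
  (`Lichtman2020.Smoothed.dirichletMeanValue33_strong`) and Lemma 4.8 (proved in the tree,
  `Lichtman2020_liouvilleCharacterSifted_holds`): `Lichtman2020.liouvilleMeanSquare33_of_primeCharacterSum`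
  is the tree's `Lichtman2020_liouvilleMeanSquareWith_of_dirichletMeanValueWith` at `c = 33`.
* `Lichtman2020_majorArcEstimate_of_primeCharacterSum`, `…_of_khale` — **Proposition 3.2**
  (`Lichtman2020_majorArcEstimate`, `MoebiusShiftedPrimesArcs.lean`: the key major arc estimate
  `≪ HX/(dW)`, printed set), through the tree's proved deduction
  `Lichtman2020_majorArcEstimate_of_liouvilleMeanSquare` (pp. 10–11).

So `Lichtman2020_majorArcEstimate_holds` and `Lichtman2020_liouvilleMeanSquare_holds` need
`Khale2024_zeroFreeRegion` (or Lemma 4.5) to be proved in the tree, nothing else.  (The tree's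
`MoebiusShiftedPrimesMajorArcs33.lean` obtains, by a different re-balancing that stays within the printed
Lemma 4.7, the weaker major-arc bound `HX/(dW^{1/5})` — enough for Proposition 2.3 — but not the printed
Proposition 3.2; the present route keeps the printed savings by making the first Ramaré decomposition
exact, see the module docstring of `MoebiusShiftedPrimesSmoothedRamare.lean`.)

## Sources

* J. D. Lichtman, arXiv:2009.08969v2: Propositions 3.2, 3.4, pp. 9–11; "Proof of Proposition 3.4 from
  Proposition 5.1", (5.1)–(5.6), p. 14; Lemmas 4.1, 4.5, 4.6, 4.8, pp. 11–13 [Lichtman2020].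
* T. Khale, Q. J. Math. 75 (2024) 299–332, Theorem 1.1 [Khale2024].
-/

noncomputable section

open Filter Asymptotics Finset MeasureTheory
open scoped Topology

namespace Literature.NumberTheory.Sieve

namespace Lichtman2020

/-! ### Proposition 3.4 at the printed exponent -/

-- The assembly below is long but linear (ten filters, two piece bounds, numerics); it needs about
-- twice the default heartbeat budget.
set_option maxHeartbeats 400000 in
open ArithmeticFunction in
/-- **Lichtman 2020, Proposition 3.4 at the printed exponent (`lichtmanTypicalWith 33 = lichtmanTypical`)
from Lemma 4.5** ("Proof of Proposition 3.4 from Proposition 5.1", p. 14, exactly as the tree's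
`Lichtman2020_liouvilleMeanSquareWith_of_dirichletMeanValueWith` with `c = 33`): Proposition 5.1 at the
printed exponent is `Smoothed.dirichletMeanValue33_strong h45`, Lemma 4.8 is
`Lichtman2020_liouvilleCharacterSifted_holds`, Lemma 4.6 (Parseval) and Lemma 4.1 are proved in the
tree.  With `ℓ = log X`, `T₀ = ℓ^{22A}`, `h₂ = Y/T₀³`, `K = 71A`; constant
`24·2431²(4004 + 72C₅) + 2(24C₈2^{71A})²`. [cite: Lichtman2020, Proposition 3.4] -/
theorem liouvilleMeanSquare33_of_primeCharacterSum (h45 : Lichtman2020_primeCharacterSum) :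
    ∀ A : ℝ, 5 < A → ∀ δ : ℝ, 0 < δ → ∀ H : ℕ → ℕ,
    Tendsto (fun X : ℕ => Real.log (H X) / Real.log (Real.log X)) atTop atTop →
    (∀ᶠ X : ℕ in atTop, (H X : ℝ) ≤ Real.exp (Real.log X ^ (2 / 3 : ℝ))) →
    ∃ C : ℝ, ∀ᶠ X : ℕ in atTop, ∀ q : ℕ, 1 ≤ q → (q : ℝ) ≤ Real.log X ^ A →
      ∀ χ : DirichletCharacter ℂ q, ∀ h : ℕ,
        (H X : ℝ) / Real.log X ^ (5 * A) ≤ h → h ≤ H X →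
        ∀ Y : ℝ, (X : ℝ) / Real.log X ^ (6 * A) ≤ Y → Y ≤ X →
          ∫ x in Y..2 * Y,
              ‖∑ m ∈ (Icc ⌈x⌉₊ ⌊x + h⌋₊).filter (lichtmanTypicalWith 33 X A δ (H X)),
                  ((ArithmeticFunction.liouville m : ℤ) : ℂ) * χ (m : ZMod q)‖ ^ 2
            ≤ C * ((h : ℝ) ^ 2 * Y / Real.log X ^ (10 * A)) := by
  intro A hA δ hδ H hH hHexp
  -- the filters by `lichtmanTypicalWith 33` and by the printed `lichtmanTypical` agree (`rfl` pointwise)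
  have filter_typicalWith33_eq : ∀ (X' A' δ' H' : ℝ) (R : Finset ℕ),
      R.filter (lichtmanTypicalWith 33 X' A' δ' H') = R.filter (lichtmanTypical X' A' δ' H') := by
    intro X' A' δ' H' R
    ext n
    simp only [Finset.mem_filter]
    exact Iff.rfl
  have hA0 : 0 < A := by linarith
  have hc1 : (1 : ℝ) < 33 := by norm_num
  obtain ⟨C₅, h5⟩ := Smoothed.dirichletMeanValue33_strong h45 A hA δ hδ H hH hHexp
  obtain ⟨C₈, h8⟩ := Lichtman2020_liouvilleCharacterSifted_holds (2 * A) (71 * A) (by linarith) (by linarith)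
  have hC₅'0 : 0 ≤ max C₅ 0 := le_max_right _ _
  have hC₈'0 : 0 ≤ max C₈ 0 := le_max_right _ _
  have hE₀1 : max (2 / 3 : ℝ) (1 - δ / 2) < 1 := max_lt (by norm_num) (by linarith)
  refine ⟨24 * 2431 ^ 2 * (4004 + 72 * max C₅ 0) + 2 * (24 * max C₈ 0 * 2 ^ (71 * A)) ^ 2, ?_⟩
  filter_upwards [h5, hHexp, eventually_rpow_log_le_H hH (15 * A), eventually_cond_a hA0,
    eventually_cond_b hA0, eventually_cond_d hA0, eventually_cond_e hA0, eventually_cond_f hE₀1,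
    tendsto_log_natCast.eventually_ge_atTop (4 * 3 + 8), eventually_ge_atTop 3]
    with X h5X hHX hH15 hGa hGb hGd hGe hGf hℓbig hX3
  intro q hq hqA χ h hh1 hh2 Y hY1 hY2
  -- the scale `ℓ = log X`
  set ℓ := Real.log X with hℓdef
  have hℓ4 : 4 ≤ ℓ := by linarith
  have hℓ1 : 1 ≤ ℓ := by linarith
  have hℓ0 : 0 < ℓ := by linarith
  have hX3' : (3 : ℝ) ≤ X := by exact_mod_cast hX3
  have hX0 : (0 : ℝ) < X := by linarith
  have hX1 : (1 : ℝ) < X := by linarith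
  have hXexp : Real.exp ℓ = X := Real.exp_log hX0
  -- `H`, `h`
  have hHx0 : (0 : ℝ) < H X := lt_of_lt_of_le (Real.rpow_pos_of_pos hℓ0 _) hH15
  have hh2r : (h : ℝ) ≤ H X := by exact_mod_cast hh2
  have hh0 : (0 : ℝ) < h := lt_of_lt_of_le (div_pos hHx0 (Real.rpow_pos_of_pos hℓ0 _)) hh1
  have hh1' : (1 : ℝ) ≤ h := by
    have : 0 < h := by exact_mod_cast hh0
    exact_mod_cast this
  -- `Y`
  have hGa' : 6 * A * Real.log ℓ ≤ ℓ / 2 := by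
    have : (0 : ℝ) ≤ Real.log 2 := Real.log_nonneg (by norm_num); linarith
  have hYℓ : ℓ / 2 ≤ Y := (half_log_le_div_rpow hXexp hℓ0 hGa').trans hY1
  have hY2' : 2 ≤ Y := by linarith
  have hY1' : 1 ≤ Y := by linarith
  have hY0 : 0 < Y := by linarith
  -- `T₀`, `h₂`, `U`
  have hT₀1 : 1 ≤ ℓ ^ (22 * A) := Real.one_le_rpow hℓ1 (by positivity)
  have hhh₂ : (h : ℝ) ≤ Y / (ℓ ^ (22 * A)) ^ 3 := h_le_h₂ hXexp hℓ1 hh2r hHX hY1 hGb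
  have hh₂0 : 0 ≤ Y / (ℓ ^ (22 * A)) ^ 3 := by positivity
  have hh₂Y : Y / (ℓ ^ (22 * A)) ^ 3 ≤ Y := div_le_self hY0.le (one_le_pow₀ hT₀1)
  have hT₀U : ℓ ^ (22 * A) ≤ Y / h := T₀_le_U hXexp hℓ1 hA0.le hh0 hh2r hHX hY1 hGb
  have hU : Y ^ (1 / 2 : ℝ) ≤ Y / h := sqrt_le_U' hXexp hℓ1 hh0 hh2r hHX hY1 hGd
  have hQ0 : (0 : ℝ) ≤ H X / ℓ ^ (4 * A) := by positivity
  have hℓ11 : 0 < ℓ ^ (11 * A) := Real.rpow_pos_of_pos hℓ0 _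
  have hL0 : (0 : ℝ) ≤ 1 / ℓ ^ (11 * A) := by positivity
  have hη0 : 0 ≤ 24 * max C₈ 0 * Y / (ℓ / 2) ^ (71 * A) := by positivity
  -- the long windows ((5.3))
  have h8' := lemma48_at_points χ hc1 hA0 hδ h8 hX1 hℓ4 hℓbig hHX hGa hGe hGf hq hqA hY1 hY2 hYℓ
  have hlogN : ∀ N : ℕ, Y / 2 ≤ N → (N : ℝ) ≤ 3 * Y → ℓ / 2 ≤ Real.log N := by
    intro N hN1 hN2
    have hN1' : (X : ℝ) / (2 * Real.log X ^ (6 * A)) ≤ N := by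
      have : (X : ℝ) / (2 * Real.log X ^ (6 * A)) = X / Real.log X ^ (6 * A) / 2 := by
        rw [div_div, mul_comm]
      rw [this]; linarith
    exact (log_point_bounds hX1 (by linarith) hGa hN1' (hN2.trans (by linarith))).1
  have hS₂ : ∀ x ∈ Set.Icc Y (2 * Y),
      ‖∑ m ∈ (Finset.Icc ⌈x⌉₊ ⌊x + Y / (ℓ ^ (22 * A)) ^ 3⌋₊).filter
        (lichtmanTypicalWith 33 X A δ (H X)),
        ((liouville m : ℤ) : ℂ) * χ (m : ZMod q)‖ ≤ 24 * max C₈ 0 * Y / (ℓ / 2) ^ (71 * A) :=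
    fun x hx => norm_longWindow_le χ hY2' hh₂0 hh₂Y hx hC₈'0 (by positivity) (by linarith) hlogN h8'
  -- the two Proposition-5.1 bounds at the scale `Y`
  have hY2X : Y ≤ 2 * (X : ℝ) := by linarith
  haveI : NeZero q := ⟨by omega⟩
  have hP₁ : DirichletPieceBound (lichtmanTypicalWith 33 X A δ (H X))
      (fun n => ((liouville n : ℤ) : ℂ) * χ (n : ZMod q)) Y (ℓ ^ (22 * A)) (max C₅ 0)
      (H X / ℓ ^ (4 * A)) (1 / ℓ ^ (11 * A)) :=
    pieceBound_of_prop51 hℓ11 hY0 hY2X hQ0 fun T hT1 hT2 => by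
      rw [filter_typicalWith33_eq]; exact h5X q hq hqA χ Y hY1 hY2X T hT1 hT2
  have hP₃ : DirichletPieceBound (lichtmanTypicalWith 33 X A δ (H X))
      (fun n => star (((liouville n : ℤ) : ℂ) * χ (n : ZMod q))) Y (ℓ ^ (22 * A)) (max C₅ 0)
      (H X / ℓ ^ (4 * A)) (1 / ℓ ^ (11 * A)) := by
    rw [star_liouville_mul_char χ]
    exact pieceBound_of_prop51 hℓ11 hY0 hY2X hQ0 fun T hT1 hT2 => by
      rw [filter_typicalWith33_eq]; exact h5X q hq hqA χ⁻¹ Y hY1 hY2X T hT1 hT2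
  -- the skeleton
  have main := meanSquare_le_of_pieces_trunc (lichtmanTypicalWith 33 X A δ (H X))
    (c := fun n => ((liouville n : ℤ) : ℂ) * χ (n : ZMod q)) (norm_liouville_mul_char_le χ)
    hY1' hT₀1 hh1' hhh₂ le_rfl hη0 hC₅'0 hQ0 hL0 hT₀U hU hS₂ hP₁ hP₃
  refine main.trans ?_
  -- numerics
  have hX16 : ℓ ^ (16 * A) ≤ X := by
    refine rpow_log_le_self hXexp hℓ0 ?_
    have h1 : 0 ≤ Real.log ℓ := Real.log_nonneg hℓ1
    have h2 : 0 ≤ ℓ ^ (2 / 3 : ℝ) := Real.rpow_nonneg hℓ0.le _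
    nlinarith
  have hn1 := numerics_T₀ hℓ1 hA0.le (ℓ := ℓ)
  have hn2 := numerics_main hℓ1 hA0.le hC₅'0 hHx0 hh1 (A := A)
  have hn3 := numerics_h hℓ1 hH15 hh1
  have hn4 := numerics_Y hℓ1 hX16 hY1
  rw [numerics_eta hℓ1 hY0]
  have hι : 0 < 1 / ℓ ^ (10 * A) := by positivity
  have hsum : 2000 / (ℓ ^ (22 * A)) ^ 2 + 36 * max C₅ 0 * (H X / ℓ ^ (4 * A) / h + 1) * (1 / ℓ ^ (11 * A))
      + 2000 / h + 4 / Y ≤ (4004 + 72 * max C₅ 0) * (1 / ℓ ^ (10 * A)) := by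
    linarith
  have hpre : 0 ≤ 24 * 2431 ^ 2 * (h : ℝ) ^ 2 * Y := by positivity
  have h1 := mul_le_mul_of_nonneg_left hsum hpre
  have e : (h : ℝ) ^ 2 * Y / ℓ ^ (10 * A) = (h : ℝ) ^ 2 * Y * (1 / ℓ ^ (10 * A)) := by
    rw [mul_one_div]
  rw [e]
  linarith [h1]

end Lichtman2020

open Lichtman2020 in
/-- **Lichtman 2020, Proposition 3.4 AS PRINTED (`Lichtman2020_liouvilleMeanSquare`), conditional on
Lemma 4.5** (`Lichtman2020_primeCharacterSum`), every other input being proved in the tree.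
[cite: Lichtman2020, Proposition 3.4] -/
theorem Lichtman2020_liouvilleMeanSquare_of_primeCharacterSum (h45 : Lichtman2020_primeCharacterSum) :
    Lichtman2020_liouvilleMeanSquare := by
  intro A hA δ hδ H hH hHexp
  obtain ⟨C, hC⟩ := liouvilleMeanSquare33_of_primeCharacterSum h45 A hA δ hδ H hH hHexp
  refine ⟨C, ?_⟩
  have filter_typicalWith33_eq : ∀ (X' A' δ' H' : ℝ) (R : Finset ℕ),
      R.filter (lichtmanTypicalWith 33 X' A' δ' H') = R.filter (lichtmanTypical X' A' δ' H') := by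
    intro X' A' δ' H' R
    ext n
    simp only [Finset.mem_filter]
    exact Iff.rfl
  filter_upwards [hC] with X hX q hq hqA χ h hh1 hh2 Y hY1 hY2
  have key := hX q hq hqA χ h hh1 hh2 Y hY1 hY2
  simpa only [filter_typicalWith33_eq] using key

/-- **Lichtman 2020, Proposition 3.4 AS PRINTED, conditional on Khale's Vinogradov–Korobov zero-free
region** (through `Lichtman2020_primeCharacterSum_of_khale`). [cite: Lichtman2020, Proposition 3.4] -/
theorem Lichtman2020_liouvilleMeanSquare_of_khale
    (hK : Literature.NumberTheory.LFunctions.Khale2024_zeroFreeRegion) : Lichtman2020_liouvilleMeanSquare :=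
  Lichtman2020_liouvilleMeanSquare_of_primeCharacterSum
    (Lichtman2020.PrimeCharSum.Lichtman2020_primeCharacterSum_of_khale hK)

/-- **Lichtman 2020, Proposition 3.2 AS PRINTED (`Lichtman2020_majorArcEstimate`, the key major arc
estimate `≪ HX/(dW)` on the printed typical set), conditional on Lemma 4.5**
(`Lichtman2020_primeCharacterSum`): the tree's proved deduction of Proposition 3.2 from Proposition 3.4
(`Lichtman2020_majorArcEstimate_of_liouvilleMeanSquare`, pp. 10–11) applied to
`Lichtman2020_liouvilleMeanSquare_of_primeCharacterSum`. [cite: Lichtman2020, Proposition 3.2] -/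
theorem Lichtman2020_majorArcEstimate_of_primeCharacterSum (h45 : Lichtman2020_primeCharacterSum) :
    Lichtman2020_majorArcEstimate :=
  Lichtman2020_majorArcEstimate_of_liouvilleMeanSquare (Lichtman2020_liouvilleMeanSquare_of_primeCharacterSum h45)

/-- **Lichtman 2020, Proposition 3.2 AS PRINTED, conditional on Khale's explicit Vinogradov–Korobov
zero-free region for Dirichlet `L`-functions** (`Khale2024_zeroFreeRegion`, Q. J. Math. 75 (2024),
Theorem 1.1) — the only printed theorem of the whole deduction not proved in the tree: an unconditional
`Lichtman2020_majorArcEstimate_holds` needs exactly `Khale2024_zeroFreeRegion` (or Lemma 4.5).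
[cite: Lichtman2020, Proposition 3.2] -/
theorem Lichtman2020_majorArcEstimate_of_khale
    (hK : Literature.NumberTheory.LFunctions.Khale2024_zeroFreeRegion) : Lichtman2020_majorArcEstimate :=
  Lichtman2020_majorArcEstimate_of_primeCharacterSum
    (Lichtman2020.PrimeCharSum.Lichtman2020_primeCharacterSum_of_khale hK)

end Literature.NumberTheory.Sieve
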